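import Summits.Langlands.Langlands.Theorems.LevelOneDyadicKernel
import Literature.NumberTheory.GaloisRepresentations.ToLocalRestrictField
import Literature.NumberTheory.GaloisRepresentations.OrdinaryGaloisRep
import Literature.NumberTheory.GaloisRepresentations.HeckeCharacter

/-!
Part 5/5 of the support module of the decomp-langlands lens-4 nodes (g6 `LevelOneNormalForm`, g7 `DyadicCompanion`, g8 `DyadicRigiditySplit`)
for route-Langlands-MinimalLevelDescent rev 3 (crux Z = `MinimalLevelDescent.LevelOneCrystallineDescent`, stmt-Langlands-31277); SAME namespace
`Summit.Langlands.Langlands.Theorems.LevelOneDyadic` as Parts 1–4 (`MinimalLevelDescentDyadicDefs`, `LevelOneDyadicFrame`, `LevelOneDyadicTower`,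
`LevelOneDyadicKernel`), imports Part 4.  0 sorry; axioms standard.

# Part 5 — THE RIGIDITY SPLIT OF E (g8):  E ⟸ T ∧ G, carved along barrier B8 `Literature.Barriers.Langlands.MonodromyNotClosedUnderPadicLimits`
(v ∣ p twin: p-adic limits of de Rham representations need not be de Rham).  Vocabulary `IsDeRhamAbove`; pieces T `DyadicContinuousCompanion`
(continuous a.e.-unramified 2-adic companion with matching Frobenius polynomials — the limit-stable half) and G `DyadicDeRhamRigidity` (every such
matched ρ₂ is de Rham above 2 — the half not closed under limits); kernels `dyadicCompanionExistence_of_TG : T → G → E`, `dyadicContinuousCompanion_of_E`,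
`dyadicDeRhamRigidity_of_E_I : E → I → G` (Deligne–Serre conjugacy + frame invariance), `dyadicCompanionExistence_iff_TG (hI) : E ↔ T ∧ G`,
`dyadicLevelOneCompanion_iff_four : C₂ ↔ T ∧ G ∧ I ∧ U`, necessity `…_of_langlands`, the pointwise sector theorem
`isPinnedGeometric_of_irreducible_companion`, the n = 1 rungs of E/T/G modulo the two catalogued rank-one facts taken fibrewise,
`item_31277_of_four : T → G → I → U → MinimalLevelDescent.LevelOneCrystallineDescent` (THE TREE ITEM BY NAME) and the deciding theorems
`langlands_of_four` / `langlands_of_four_tree`.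
-/

set_option linter.dupNamespace false

namespace Summit.Langlands.Langlands.Theorems.LevelOneDyadic

open scoped NumberField
open Filter IsDedekindDomain Polynomial
open Literature.NumberTheory.GaloisRepresentations Literature.NumberTheory.Automorphic
open Summit.Langlands.Langlands.Theses

variable {K : Type} [Field K] [NumberField K] {ℓ : ℕ} [Fact ℓ.Prime] {n : ℕ}

/-! # g8 — THE RIGIDITY SPLIT OF THE RESIDUAL E:  E ⟸ T ∧ G  (so Z ⟸ T ∧ G ∧ I ∧ U), carved along barrier B8
`Literature.Barriers.Langlands.MonodromyNotClosedUnderPadicLimits` (its `v ∣ p` twin: "p-adic limits of de Rham representations need not be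
de Rham"): T = the LIMIT-STABLE half of a companion (continuity, a.e. unramifiedness, Frobenius polynomials — everything congruences /
interpolation / pseudocharacters can deliver), G = the half that is NOT closed under 2-adic limits (de Rham above 2 — Fontaine–Mazur
rigidity of the matched representation).  New vocabulary `IsDeRhamAbove`; new pieces T `DyadicContinuousCompanion`, G `DyadicDeRhamRigidity`;
kernels: E ⟸ T ∧ G, T ⟸ E, G ⟸ E ∧ I (Deligne–Serre conjugacy + frame invariance of de Rham-ness), hence E ⟺ T ∧ G modulo I and
C₂ ⟺ T ∧ G ∧ I ∧ U modulo NOTHING; necessity Langlands ⟹ T, G; the rank-one rungs E, T, G at n = 1 modulo the two catalogued rank-one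
facts taken fibrewise as hypotheses (Patrikis 2019 Prop. 2.2.1 / Serre 1968 Ch. III: the fibres of `FramedGaloisRep.exists_heckeCharacter_of_isDeRhamFramed`,
`HeckeCharacter.exists_lAdic_isDeRhamFramed`); `item_31277_of_four`, `closes₈`. -/

section Rigidity

variable {p : ℕ} [Fact p.Prime]

/-- de Rham above p for Fontaine's pinned datum (the second clause of `IsPinnedGeometric`, isolated). -/
def IsDeRhamAbove (ρ₂ : FramedGaloisRep K (PadicAlgCl p) n) : Prop :=
  ∀ (v : IsDedekindDomain.HeightOneSpectrum (NumberField.RingOfIntegers K)) (hv : ((p : ℕ) : NumberField.RingOfIntegers K) ∈ v.asIdeal),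
    (Literature.NumberTheory.PAdicHodge.fontainePstAdicCompletion v p hv).IsDeRhamFramed (ρ₂.toLocal v)

/-- `IsPinnedGeometric ρ₂ ↔ (a.e. unramified) ∧ IsDeRhamAbove ρ₂` — by `Iff.rfl`. -/
theorem isPinnedGeometric_iff_and (ρ₂ : FramedGaloisRep K (PadicAlgCl p) n) :
    IsPinnedGeometric ρ₂ ↔ (∀ᶠ v : HeightOneSpectrum (𝓞 K) in cofinite, ρ₂.IsUnramifiedAt v) ∧ IsDeRhamAbove ρ₂ :=
  Iff.rfl

/-! ## The two new pieces (one-line self-contained Props over tree declarations = the texts of `texts.json`) -/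

/-- [crux · THE NEW RESIDUAL · WEAKER than the summit (`dyadicContinuousCompanion_of_langlands`), than C₂ and than E
(`dyadicContinuousCompanion_of_E`: the de Rham clause dropped), than the OPEN ITEM stmt-Langlands-18969 (`dyadicContinuousCompanion_of_geometricCompanions`) ·
LEAF TAGS: IDEA-NEEDED in general (no construction in print turns the Frobenius polynomials of an ABSTRACT geometric ρ into a continuous
representation at another prime except through automorphy or a motive); ATTACKABLE = THEOREM-GRADE on two sectors: (a) the polarizable
regular potentially-diagonalizable sector — Barnet-Lamb–Gee–Geraghty–Taylor, arXiv:1010.2561 Thm 5.4.1 (arXiv numbering, p. 39: "r is part of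
a strictly pure compatible system"), by potential automorphy + Brauer's theorem; (b) the regular algebraic NON-polarizable sector over CM K —
Harris–Lan–Taylor–Thorne 2016 Thm A / Scholze 2015 Thm 4–5: the companion is CONSTRUCTED AS A p-ADIC LIMIT (congruences to cusp forms on
U(n,n)), i.e. exactly a T-type object, de Rham-ness being a separate later theorem (G below); rung n = 1 KERNEL modulo the two rank-one facts
(`dyadicContinuousCompanion_rank_one`) · INSTRUMENTABLE: NO (for every ρ whose Frobenius polynomials can be tabulated, ρ is automorphic and T
known) · BARRIER: none catalogued quantifies over T — B8 says what limit methods CANNOT add to T, not that T is unreachable]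
T — DYADIC CONTINUOUS COMPANION: for ρ as in C₂ (irreducible, pinned-geometric, level one, crystalline above the odd prime ℓ) and every
ι₂ : ℚ̄₂ ≅ ℂ there is a CONTINUOUS, almost everywhere unramified ρ₂ : Γ_K → GL_n(ℚ̄₂) whose Frobenius polynomials match those of ρ through
(ι, ι₂) at almost all places — no de Rham condition at 2, no irreducibility, no level.  Content: the class function
v ↦ ι₂⁻¹ι(det(X − ρ(Frob_v))) on Frobenii 2-ADICALLY INTERPOLATES to a continuous n-dimensional determinant of Γ_K (Chenevier) — for every
ι₂, which silently forces the Frobenius polynomials of ρ to be ALGEBRAIC with 2-integral conjugates (a compact image has integral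
characteristic polynomials; a transcendental coefficient has a conjugate of negative valuation).  Why strictly weaker than the summit and
than E: a bare continuity/existence statement on the Galois side; B8's twin (Bloch–Kato Ex. 3.9: H¹_g(ℚ_p, ℚ_p) ⊊ H¹) shows a continuous
a.e.-unramified matched ρ₂ need not be de Rham when the companion class is reducible, so T ↛ E without I-type input. -/
def DyadicContinuousCompanion : Prop :=
  ∀ (K : Type) [Field K] [NumberField K] (n : ℕ), 0 < n → ∀ (ℓ : ℕ) [Fact ℓ.Prime], ℓ ≠ 2 → ∀ (ι : PadicAlgCl ℓ ≃+* ℂ) (ρ : Literature.NumberTheory.GaloisRepresentations.FramedGaloisRep K (PadicAlgCl ℓ) n), ρ.toGaloisRep.IsIrreducible → ((∀ᶠ v : IsDedekindDomain.HeightOneSpectrum (NumberField.RingOfIntegers K) in cofinite, ρ.IsUnramifiedAt v) ∧ ∀ (v : IsDedekindDomain.HeightOneSpectrum (NumberField.RingOfIntegers K)) (hv : ((ℓ : ℕ) : NumberField.RingOfIntegers K) ∈ v.asIdeal), (Literature.NumberTheory.PAdicHodge.fontainePstAdicCompletion v ℓ hv).IsDeRhamFramed (ρ.toLocal v)) → (∀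 (v : IsDedekindDomain.HeightOneSpectrum (NumberField.RingOfIntegers K)) (hv : ((ℓ : ℕ) : NumberField.RingOfIntegers K) ∈ v.asIdeal), (Literature.NumberTheory.PAdicHodge.fontainePstAdicCompletion v ℓ hv).IsCrystallineFramed (ρ.toLocal v)) → (∀ w : IsDedekindDomain.HeightOneSpectrum (NumberField.RingOfIntegers K), ((ℓ : ℕ) : NumberField.RingOfIntegers K) ∉ w.asIdeal → ρ.IsUnramifiedAt w) → ∀ (ι₂ : PadicAlgCl 2 ≃+* ℂ), ∃ ρ₂ : Literature.NumberTheory.GaloisRepresentations.FramedGaloisRep K (PadicAlgCl 2) n, (∀ᶠ v : IsDedekindDomain.HeightOneSpectrum (NumberField.RingOfIntegers K) in cofinite, ρ₂.IsUnramifiedAt v) ∧ (∀ᶠ v : IsDedekindDomain.HeightOneSpectrum (NumberField.RingOfIntegers K) in cofinite, ∃ α : Multiset ℂ, ρ.HasFrobCharpolyAt v (Literature.NumberTheory.Automorphic.arithFrobPolyOfSatake ι v.residueCard 1 α) ∧ ρ₂.HasFrobCharpolyAt v (Literature.NumberTheory.Automorphic.arithFrobPolyOfSatake ι₂ v.residueCard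 1 α))

/-- [crux · WEAKER than the summit (`dyadicDeRhamRigidity_of_langlands`), than C₂ (`dyadicDeRhamRigidity_of_companion`) and than E ∧ I
(`dyadicDeRhamRigidity_of_E_I`: Deligne–Serre conjugacy to the irreducible geometric companion + frame invariance of de Rham-ness,
`PstWeilDeligneData.isDeRhamFramed_conj_iff`) · LEAF TAGS: ATTACKABLE NOW on every ρ possessing an irreducible pinned-geometric 2-adic
companion (POINTWISE kernel theorem `isDeRhamAbove_of_irreducible_companion`: all classical/Hilbert/regular-polarizable cases with known
irreducibility), rung n = 1 KERNEL modulo the two rank-one facts (`dyadicDeRhamRigidity_rank_one`), and IN PRINT on the non-polarizable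
regular CM sector: A'Campo–Hevesi–Thorne–Whitmore 2026 Thm 1.2.1 (tree fact `AHTW2026.deRham_hodgeTateRegular`: r_{π,ι}|Γ_{F_v} is de
Rham at v ∣ p — proved for a representation KNOWN ONLY AS A p-ADIC LIMIT, by degree shifting, precisely because the limit does not give it) ·
IDEA-NEEDED for an abstract matched pair with reducible companion class excluded only by I · BARRIER B8
`MonodromyNotClosedUnderPadicLimits` (v ∣ p twin) is WHY G is a separate piece: de Rham-ness is not a closed condition, so no argument
producing ρ₂ as a limit proves G; G sits OUTSIDE B8's technique class as a statement (two fixed representations, no family) and its known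
proofs (AHTW; A'Campo 2024 "rigidity") are the printed evasions]
G — DYADIC DE RHAM RIGIDITY: for ρ as in C₂ and every ι₂, EVERY continuous a.e.-unramified ρ₂ : Γ_K → GL_n(ℚ̄₂) matching ρ through (ι, ι₂)
is de Rham at every place above 2 (Fontaine's pinned datum).  Why strictly weaker than the summit: a p-adic Hodge-theoretic transfer
statement inside a matched pair, no automorphy, no existence; why not implied by E alone: E's companion may a priori be reducible and a
second, non-semisimple matched ρ₂ need not be de Rham (B8 twin) — the kernel proves G from E ∧ I, and from Langlands. -/
def DyadicDeRhamRigidity : Prop :=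
  ∀ (K : Type) [Field K] [NumberField K] (n : ℕ), 0 < n → ∀ (ℓ : ℕ) [Fact ℓ.Prime], ℓ ≠ 2 → ∀ (ι : PadicAlgCl ℓ ≃+* ℂ) (ρ : Literature.NumberTheory.GaloisRepresentations.FramedGaloisRep K (PadicAlgCl ℓ) n), ρ.toGaloisRep.IsIrreducible → ((∀ᶠ v : IsDedekindDomain.HeightOneSpectrum (NumberField.RingOfIntegers K) in cofinite, ρ.IsUnramifiedAt v) ∧ ∀ (v : IsDedekindDomain.HeightOneSpectrum (NumberField.RingOfIntegers K)) (hv : ((ℓ : ℕ) : NumberField.RingOfIntegers K) ∈ v.asIdeal), (Literature.NumberTheory.PAdicHodge.fontainePstAdicCompletion v ℓ hv).IsDeRhamFramed (ρ.toLocal v)) → (∀ (v : IsDedekindDomain.HeightOneSpectrum (NumberField.RingOfIntegers K)) (hv : ((ℓ : ℕ) : NumberField.RingOfIntegers K) ∈ v.asIdeal), (Literature.NumberTheory.PAdicHodge.fontainePstAdicCompletion v ℓ hv).IsCrystallineFramed (ρ.toLocal v)) → (∀ w : IsDedekindDomain.HeightOneSpectrum (NumberField.RingOfIntegers K), ((ℓ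 : ℕ) : NumberField.RingOfIntegers K) ∉ w.asIdeal → ρ.IsUnramifiedAt w) → ∀ (ι₂ : PadicAlgCl 2 ≃+* ℂ), ∀ (ρ₂ : Literature.NumberTheory.GaloisRepresentations.FramedGaloisRep K (PadicAlgCl 2) n), (∀ᶠ v : IsDedekindDomain.HeightOneSpectrum (NumberField.RingOfIntegers K) in cofinite, ρ₂.IsUnramifiedAt v) → (∀ᶠ v : IsDedekindDomain.HeightOneSpectrum (NumberField.RingOfIntegers K) in cofinite, ∃ α : Multiset ℂ, ρ.HasFrobCharpolyAt v (Literature.NumberTheory.Automorphic.arithFrobPolyOfSatake ι v.residueCard 1 α) ∧ ρ₂.HasFrobCharpolyAt v (Literature.NumberTheory.Automorphic.arithFrobPolyOfSatake ι₂ v.residueCard 1 α)) → ∀ (v : IsDedekindDomain.HeightOneSpectrum (NumberField.RingOfIntegers K)) (hv : ((2 : ℕ) : NumberField.RingOfIntegers K) ∈ v.asIdeal), (Literature.NumberTheory.PAdicHodge.fontainePstAdicCompletion v 2 hv).IsDeRhamFramed (ρ₂.toLocal v)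

/-! ## Bridges (all `Iff.rfl`) -/

/-- T's vocabulary form IS its one-line text over tree declarations (texts.json). [bookkeeping] -/
theorem dyadicContinuousCompanion_iff : DyadicContinuousCompanion ↔
    (∀ (K : Type) [Field K] [NumberField K] (n : ℕ), 0 < n → ∀ (ℓ : ℕ) [Fact ℓ.Prime], ℓ ≠ 2 →
      ∀ (ι : PadicAlgCl ℓ ≃+* ℂ) (ρ : FramedGaloisRep K (PadicAlgCl ℓ) n), ρ.toGaloisRep.IsIrreducible →
        IsPinnedGeometric ρ → IsCrystallineAbove ρ → IsUnramifiedAwayFrom ρ → ∀ (ι₂ : PadicAlgCl 2 ≃+* ℂ),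
          ∃ ρ₂ : FramedGaloisRep K (PadicAlgCl 2) n, (∀ᶠ v : HeightOneSpectrum (𝓞 K) in cofinite, ρ₂.IsUnramifiedAt v) ∧
            CompanionMatch ι ι₂ ρ ρ₂) :=
  Iff.rfl

/-- G's vocabulary form IS its one-line text over tree declarations (texts.json). [bookkeeping] -/
theorem dyadicDeRhamRigidity_iff : DyadicDeRhamRigidity ↔
    (∀ (K : Type) [Field K] [NumberField K] (n : ℕ), 0 < n → ∀ (ℓ : ℕ) [Fact ℓ.Prime], ℓ ≠ 2 →
      ∀ (ι : PadicAlgCl ℓ ≃+* ℂ) (ρ : FramedGaloisRep K (PadicAlgCl ℓ) n), ρ.toGaloisRep.IsIrreducible →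
        IsPinnedGeometric ρ → IsCrystallineAbove ρ → IsUnramifiedAwayFrom ρ → ∀ (ι₂ : PadicAlgCl 2 ≃+* ℂ)
          (ρ₂ : FramedGaloisRep K (PadicAlgCl 2) n), (∀ᶠ v : HeightOneSpectrum (𝓞 K) in cofinite, ρ₂.IsUnramifiedAt v) →
            CompanionMatch ι ι₂ ρ ρ₂ → IsDeRhamAbove ρ₂) :=
  Iff.rfl

/-! ## Frame invariance of pinned-geometricity; the pointwise rigidity lemma -/

/-- de Rham-ness above p does not see the frame (`FramedGaloisRep.toLocal_conj`, `PstWeilDeligneData.isDeRhamFramed_conj_iff`). -/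
theorem isDeRhamAbove_conj {ρ₁ : FramedGaloisRep K (PadicAlgCl p) n} (P : GL (Fin n) (PadicAlgCl p)) (h : IsDeRhamAbove ρ₁) :
    IsDeRhamAbove (FramedRep.conj P ρ₁) := fun v hv => by
  rw [FramedGaloisRep.toLocal_conj, PstWeilDeligneData.isDeRhamFramed_conj_iff]
  exact h v hv

/-- Pinned-geometricity is a conjugacy invariant. -/
theorem isPinnedGeometric_conj {ρ₁ : FramedGaloisRep K (PadicAlgCl p) n} (P : GL (Fin n) (PadicAlgCl p)) (h : IsPinnedGeometric ρ₁) :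
    IsPinnedGeometric (FramedRep.conj P ρ₁) :=
  ⟨h.1.mono fun v hv => (FramedGaloisRep.isUnramifiedAt_conj_iff v P ρ₁).mpr hv, isDeRhamAbove_conj P h.2⟩

/-- **POINTWISE RIGIDITY (the sector theorem of G).**  If ρ has ONE irreducible pinned-geometric p-adic companion ρ₁ through (ι, ι₂), then
EVERY a.e.-unramified ρ₂ matching ρ through (ι, ι₂) is conjugate to ρ₁ (Deligne–Serre `exists_conj_of_match`), hence pinned-geometric. -/
theorem isPinnedGeometric_of_irreducible_companion {ι : PadicAlgCl ℓ ≃+* ℂ} {ι₂ : PadicAlgCl p ≃+* ℂ} {ρ : FramedGaloisRep K (PadicAlgCl ℓ) n}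
    {ρ₁ ρ₂ : FramedGaloisRep K (PadicAlgCl p) n} (hirr₁ : ρ₁.toGaloisRep.IsIrreducible) (hgeo₁ : IsPinnedGeometric ρ₁)
    (hm₁ : CompanionMatch ι ι₂ ρ ρ₁) (hur₂ : ∀ᶠ v : HeightOneSpectrum (𝓞 K) in cofinite, ρ₂.IsUnramifiedAt v)
    (hm₂ : CompanionMatch ι ι₂ ρ ρ₂) : IsPinnedGeometric ρ₂ := by
  obtain ⟨P, rfl⟩ := exists_conj_of_match hirr₁ (eventually_common_of_match hm₁ hm₂ hgeo₁.1 hur₂)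
  exact isPinnedGeometric_conj P hgeo₁

/-- Corollary: de Rham above p of every a.e.-unramified matched ρ₂, given one irreducible pinned-geometric companion. -/
theorem isDeRhamAbove_of_irreducible_companion {ι : PadicAlgCl ℓ ≃+* ℂ} {ι₂ : PadicAlgCl p ≃+* ℂ} {ρ : FramedGaloisRep K (PadicAlgCl ℓ) n}
    {ρ₁ ρ₂ : FramedGaloisRep K (PadicAlgCl p) n} (hirr₁ : ρ₁.toGaloisRep.IsIrreducible) (hgeo₁ : IsPinnedGeometric ρ₁)
    (hm₁ : CompanionMatch ι ι₂ ρ ρ₁) (hur₂ : ∀ᶠ v : HeightOneSpectrum (𝓞 K) in cofinite, ρ₂.IsUnramifiedAt v)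
    (hm₂ : CompanionMatch ι ι₂ ρ ρ₂) : IsDeRhamAbove ρ₂ :=
  (isPinnedGeometric_of_irreducible_companion hirr₁ hgeo₁ hm₁ hur₂ hm₂).2

/-! ## STRUCTURE: E ⟸ T ∧ G, T ⟸ E, G ⟸ E ∧ I, E ⟺ T ∧ G mod I, C₂ ⟺ T ∧ G ∧ I ∧ U, necessity, rungs -/

/-- **E ⟸ T ∧ G** (the node's glue: T supplies the continuous companion, G makes it de Rham above 2). -/
theorem dyadicCompanionExistence_of_TG (hT : DyadicContinuousCompanion) (hG : DyadicDeRhamRigidity) : DyadicCompanionExistence := by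
  rw [dyadicCompanionExistence_iff]
  rw [dyadicContinuousCompanion_iff] at hT
  rw [dyadicDeRhamRigidity_iff] at hG
  intro K _ _ n hn ℓ _ hℓ2 ι ρ hirr hgeo hcrys hlev ι₂
  obtain ⟨ρ₂, hur₂, hm⟩ := hT K n hn ℓ hℓ2 ι ρ hirr hgeo hcrys hlev ι₂
  exact ⟨ρ₂, ⟨hur₂, hG K n hn ℓ hℓ2 ι ρ hirr hgeo hcrys hlev ι₂ ρ₂ hur₂ hm⟩, hm⟩

/-- T ⟸ E (drop the de Rham clause). -/
theorem dyadicContinuousCompanion_of_E (hE : DyadicCompanionExistence) : DyadicContinuousCompanion := by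
  rw [dyadicContinuousCompanion_iff]
  rw [dyadicCompanionExistence_iff] at hE
  intro K _ _ n hn ℓ _ hℓ2 ι ρ hirr hgeo hcrys hlev ι₂
  obtain ⟨ρ₂, hgeo₂, hm⟩ := hE K n hn ℓ hℓ2 ι ρ hirr hgeo hcrys hlev ι₂
  exact ⟨ρ₂, hgeo₂.1, hm⟩

/-- **G ⟸ E ∧ I**: E gives a pinned-geometric companion ρ₁, I makes it irreducible, pointwise rigidity does the rest. -/
theorem dyadicDeRhamRigidity_of_E_I (hE : DyadicCompanionExistence) (hI : DyadicIrreducibilityTransfer) : DyadicDeRhamRigidity := by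
  rw [dyadicDeRhamRigidity_iff]
  rw [dyadicCompanionExistence_iff] at hE
  rw [dyadicIrreducibilityTransfer_iff] at hI
  intro K _ _ n hn ℓ _ hℓ2 ι ρ hirr hgeo hcrys hlev ι₂ ρ₂ hur₂ hm
  obtain ⟨ρ₁, hgeo₁, hm₁⟩ := hE K n hn ℓ hℓ2 ι ρ hirr hgeo hcrys hlev ι₂
  have hirr₁ := hI K n hn ℓ hℓ2 ι ρ hirr hgeo hcrys hlev ι₂ ρ₁ hgeo₁ hm₁
  exact isDeRhamAbove_of_irreducible_companion hirr₁ hgeo₁ hm₁ hur₂ hm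

/-- EXACTNESS of the g8 split modulo I:  E ⟺ T ∧ G. -/
theorem dyadicCompanionExistence_iff_TG (hI : DyadicIrreducibilityTransfer) :
    DyadicCompanionExistence ↔ DyadicContinuousCompanion ∧ DyadicDeRhamRigidity :=
  ⟨fun hE => ⟨dyadicContinuousCompanion_of_E hE, dyadicDeRhamRigidity_of_E_I hE hI⟩, fun h => dyadicCompanionExistence_of_TG h.1 h.2⟩

/-- T ⟸ C₂. -/
theorem dyadicContinuousCompanion_of_companion (hC : DyadicLevelOneCompanion) : DyadicContinuousCompanion :=
  dyadicContinuousCompanion_of_E (dyadicCompanionExistence_of_companion hC)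

/-- G ⟸ C₂. -/
theorem dyadicDeRhamRigidity_of_companion (hC : DyadicLevelOneCompanion) : DyadicDeRhamRigidity :=
  dyadicDeRhamRigidity_of_E_I (dyadicCompanionExistence_of_companion hC) (dyadicIrreducibilityTransfer_of_companion hC)

/-- C₂ ⟸ T ∧ G ∧ I ∧ U. -/
theorem dyadicLevelOneCompanion_of_four (hT : DyadicContinuousCompanion) (hG : DyadicDeRhamRigidity)
    (hI : DyadicIrreducibilityTransfer) (hU : DyadicLevelTransfer) : DyadicLevelOneCompanion :=
  dyadicLevelOneCompanion_of_pieces (dyadicCompanionExistence_of_TG hT hG) hI hU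

/-- **EXACTNESS of the four-piece split modulo NOTHING:  C₂ ⟺ T ∧ G ∧ I ∧ U.** -/
theorem dyadicLevelOneCompanion_iff_four :
    DyadicLevelOneCompanion ↔
      DyadicContinuousCompanion ∧ DyadicDeRhamRigidity ∧ DyadicIrreducibilityTransfer ∧ DyadicLevelTransfer :=
  ⟨fun h => ⟨dyadicContinuousCompanion_of_companion h, dyadicDeRhamRigidity_of_companion h,
      dyadicIrreducibilityTransfer_of_companion h, dyadicLevelTransfer_of_companion h⟩,
    fun h => dyadicLevelOneCompanion_of_four h.1 h.2.1 h.2.2.1 h.2.2.2⟩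

/-- Z ⟸ T ∧ G ∧ I ∧ U. -/
theorem levelOneCrystallineDescent_of_four (hT : DyadicContinuousCompanion) (hG : DyadicDeRhamRigidity)
    (hI : DyadicIrreducibilityTransfer) (hU : DyadicLevelTransfer) : LevelOneCrystallineDescent :=
  levelOneCrystallineDescent_of_companion (dyadicLevelOneCompanion_of_four hT hG hI hU)

/-- T ⟸ the OPEN ITEM stmt-Langlands-18969 (`CompatibleFamilySplit.GeometricCompanions`), by name. -/
theorem dyadicContinuousCompanion_of_geometricCompanions (h : CompatibleFamilySplit.GeometricCompanions) :
    DyadicContinuousCompanion :=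
  dyadicContinuousCompanion_of_E (dyadicCompanionExistence_of_geometricCompanions h)

/-- NECESSITY: `Langlands ⟹ T`. -/
theorem dyadicContinuousCompanion_of_langlands (hLg : _root_.Langlands) : DyadicContinuousCompanion :=
  dyadicContinuousCompanion_of_companion (dyadicLevelOneCompanion_of_langlands hLg)

/-- NECESSITY: `Langlands ⟹ G`. -/
theorem dyadicDeRhamRigidity_of_langlands (hLg : _root_.Langlands) : DyadicDeRhamRigidity :=
  dyadicDeRhamRigidity_of_companion (dyadicLevelOneCompanion_of_langlands hLg)

/-! ## RUNGS at n = 1 — modulo the two catalogued RANK-ONE FACTS, taken FIBREWISE as hypotheses `h₁` (at K, ℓ) and `h₂` (at K, p):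
`h₁` is VERBATIM the (K, ℓ)-fibre of `Literature.NumberTheory.GaloisRepresentations.FramedGaloisRep.exists_heckeCharacter_of_isDeRhamFramed`
(module `Literature.NumberTheory.GaloisRepresentations.DeRhamLAdicCharacterHecke`; de Rham ℓ-adic character ⟹ algebraic Hecke character:
Patrikis 2019 Prop. 2.2.1 / Fontaine–Mazur for characters) and `h₂` the (K, p)-fibre of `…HeckeCharacter.exists_lAdic_isDeRhamFramed` (module
`…WeilLAdicCharacterDeRham`; algebraic Hecke character ⟹ de Rham λ-adic avatar: Serre 1968 Ch. III, Weil 1956) — so `rank_one h₁ h₂ := fact₁ K ℓ,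
fact₂ K p` once those modules are imported.  They are NOT imported here only because both modules were UNBUILT on the Lean farm on 2026-08-30
(`lean check` → rc 75 `remote:…:unbuilt:Literature.NumberTheory.GaloisRepresentations.WeilLAdicCharacterDeRham`); nothing is restated as a `def`. -/

/-- Only finitely many places lie above a rational prime. -/
theorem eventually_natCast_notMem (K : Type) [Field K] [NumberField K] (r : ℕ) (hr : r ≠ 0) :
    ∀ᶠ v : HeightOneSpectrum (𝓞 K) in cofinite, ((r : ℕ) : 𝓞 K) ∉ v.asIdeal := by
  have h0 : (Ideal.span {((r : ℕ) : 𝓞 K)} : Ideal (𝓞 K)) ≠ ⊥ := by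
    rw [Ne, Ideal.span_singleton_eq_bot]; exact_mod_cast hr
  refine Set.Finite.eventually_cofinite_notMem ((Ideal.finite_factors h0).subset fun v hv => ?_)
  change v.asIdeal ∣ Ideal.span {((r : ℕ) : 𝓞 K)}
  rw [Ideal.dvd_span_singleton]
  exact hv

/-- `arithFrobPolyOfSatake ι q 1 {a} = X − ι⁻¹(a⁻¹)` (the rank-one dictionary of the Hecke-character facts). -/
theorem arithFrobPolyOfSatake_one_singleton {r : ℕ} [Fact r.Prime] (ι : PadicAlgCl r ≃+* ℂ) (q : ℕ) (a : ℂ) :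
    arithFrobPolyOfSatake ι q 1 {a} = X - C (ι.symm a⁻¹) := by
  rw [arithFrobPolyOfSatake_one, Multiset.map_singleton, Multiset.prod_singleton]

section RankOne

variable
  (h₁ : ∀ (ψ : FramedGaloisRep K (PadicAlgCl ℓ) 1),
    (∀ (v : HeightOneSpectrum (𝓞 K)) (hv : ((ℓ : ℕ) : 𝓞 K) ∈ v.asIdeal),
      (Literature.NumberTheory.PAdicHodge.fontainePstAdicCompletion v ℓ hv).IsDeRhamFramed (ψ.toLocal v)) →
    ∀ (ι : PadicAlgCl ℓ ≃+* ℂ), ∃ χ : HeckeCharacter K, χ.IsAlgebraic ∧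
      ∀ᶠ v : HeightOneSpectrum (𝓞 K) in cofinite, χ.IsUnramifiedAt v ∧ ψ.IsUnramifiedAt v ∧
        ψ.HasFrobCharpolyAt v (X - C (ι.symm (χ.valueAtUniformizer v)⁻¹)))
  (h₂ : ∀ (χ : HeckeCharacter K), χ.IsAlgebraic → ∀ (ι : PadicAlgCl p ≃+* ℂ),
    ∃ r : FramedGaloisRep K (PadicAlgCl p) 1,
      (∀ v : HeightOneSpectrum (𝓞 K), ((p : ℕ) : 𝓞 K) ∉ v.asIdeal → χ.IsUnramifiedAt v →
        r.IsUnramifiedAt v ∧ r.HasFrobCharpolyAt v (X - C (ι.symm (χ.valueAtUniformizer v)⁻¹))) ∧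
      ∀ (v : HeightOneSpectrum (𝓞 K)) (hv : ((p : ℕ) : 𝓞 K) ∈ v.asIdeal),
        (Literature.NumberTheory.PAdicHodge.fontainePstAdicCompletion v p hv).IsDeRhamFramed (r.toLocal v))

include h₁ h₂

/-- **E at n = 1** (hence T at n = 1): a pinned-geometric ℓ-adic character is the avatar of an algebraic Hecke character χ (h₁), whose p-adic
avatar through ι₂ (h₂) is de Rham above p, unramified wherever χ is and p ∤ v, and matches through α_v = {χ(ϖ_v)}. -/
theorem dyadicCompanionExistence_rank_one (ι : PadicAlgCl ℓ ≃+* ℂ) (ρ : FramedGaloisRep K (PadicAlgCl ℓ) 1) (hgeo : IsPinnedGeometric ρ)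
    (ι₂ : PadicAlgCl p ≃+* ℂ) : ∃ ρ₂ : FramedGaloisRep K (PadicAlgCl p) 1, IsPinnedGeometric ρ₂ ∧ CompanionMatch ι ι₂ ρ ρ₂ := by
  obtain ⟨χ, hχ, hρχ⟩ := h₁ ρ hgeo.2 ι
  obtain ⟨r, hr, hdR⟩ := h₂ χ hχ ι₂
  have hp := eventually_natCast_notMem K p (Fact.out : p.Prime).ne_zero
  refine ⟨r, ⟨?_, hdR⟩, ?_⟩
  · filter_upwards [hρχ, hp] with v ⟨hχv, _, _⟩ hv
    exact (hr v hv hχv).1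
  · filter_upwards [hρχ, hp] with v ⟨hχv, _, hfrob⟩ hv
    refine ⟨{χ.valueAtUniformizer v}, ?_, ?_⟩
    · rw [arithFrobPolyOfSatake_one_singleton]; exact hfrob
    · rw [arithFrobPolyOfSatake_one_singleton]; exact (hr v hv hχv).2

/-- **T at n = 1** (mod h₁, h₂). -/
theorem dyadicContinuousCompanion_rank_one (ι : PadicAlgCl ℓ ≃+* ℂ) (ρ : FramedGaloisRep K (PadicAlgCl ℓ) 1) (hgeo : IsPinnedGeometric ρ)
    (ι₂ : PadicAlgCl p ≃+* ℂ) : ∃ ρ₂ : FramedGaloisRep K (PadicAlgCl p) 1,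
      (∀ᶠ v : HeightOneSpectrum (𝓞 K) in cofinite, ρ₂.IsUnramifiedAt v) ∧ CompanionMatch ι ι₂ ρ ρ₂ := by
  obtain ⟨ρ₂, hgeo₂, hm⟩ := dyadicCompanionExistence_rank_one h₁ h₂ ι ρ hgeo ι₂
  exact ⟨ρ₂, hgeo₂.1, hm⟩

/-- **G at n = 1** (mod h₁, h₂): the matched character is conjugate (= equal) to the de Rham avatar (a line is irreducible,
`IrreducibleOffSector.isIrreducible_of_rank_one`; Deligne–Serre conjugacy `exists_conj_of_match`; frame invariance `isDeRhamAbove_conj`). -/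
theorem dyadicDeRhamRigidity_rank_one (ι : PadicAlgCl ℓ ≃+* ℂ) (ρ : FramedGaloisRep K (PadicAlgCl ℓ) 1) (hgeo : IsPinnedGeometric ρ)
    (ι₂ : PadicAlgCl p ≃+* ℂ) (ρ₂ : FramedGaloisRep K (PadicAlgCl p) 1)
    (hur₂ : ∀ᶠ v : HeightOneSpectrum (𝓞 K) in cofinite, ρ₂.IsUnramifiedAt v) (hm : CompanionMatch ι ι₂ ρ ρ₂) : IsDeRhamAbove ρ₂ := by
  obtain ⟨ρ₁, hgeo₁, hm₁⟩ := dyadicCompanionExistence_rank_one h₁ h₂ ι ρ hgeo ι₂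
  exact isDeRhamAbove_of_irreducible_companion
    (Summit.Langlands.Langlands.Theorems.IrreducibleOffSector.isIrreducible_of_rank_one ρ₁) hgeo₁ hm₁ hur₂ hm

end RankOne

end Rigidity

/-! ## g8: THE TREE ITEM Z (31277) FROM THE FOUR PIECES; DECIDING THEOREMS -/

section Structure8

/-- **THE TREE ITEM Z (stmt-Langlands-31277) FROM T, G, I, U.** -/
theorem item_31277_of_four (hT : DyadicContinuousCompanion) (hG : DyadicDeRhamRigidity) (hI : DyadicIrreducibilityTransfer)
    (hU : DyadicLevelTransfer) : MinimalLevelDescent.LevelOneCrystallineDescent :=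
  item_31277_of_pieces (dyadicCompanionExistence_of_TG hT hG) hI hU

/-- `langlands_of_four_tree` (the node's `closes₈_tree`) THROUGH THE TREE: T G I U + the tree items K 31276, glue 31278, W 31274, L 31275 and the route of record's `closes`
(thirteen binders → `_root_.Langlands`). -/
theorem langlands_of_four_tree (hT : DyadicContinuousCompanion) (hG : DyadicDeRhamRigidity) (hI : DyadicIrreducibilityTransfer)
    (hU : DyadicLevelTransfer) (hK : MinimalLevelDescent.ResidualInertiaDescent) (hGl : MinimalLevelDescent.LevelPrimeDescent_of_resplit)
    (hWM : MinimalLevelDescent.WeightMove) (hLM : MinimalLevelDescent.LevelMove)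
    (hB : MinimalLevelDescent.DyadicLevelOneAutomorphy) (hL : MinimalLevelDescent.AutomorphyLifting)
    (hW : MinimalLevelDescent.SatakeAvatarExistence) (hP : MinimalLevelDescent.PadicMemberCompatibility)
    (hA : MinimalLevelDescent.CompatibilityAwayFromLR) (hR : MinimalLevelDescent.CanonicalReciprocityData) :
    _root_.Langlands :=
  MinimalLevelDescent.closes (hGl hWM hLM hK (item_31277_of_four hT hG hI hU)) hB hL hW hP hA hR

/-- `langlands_of_four` (the node's `closes₈`) — **DECIDING THEOREM of the g8 node**: T G I U K W L + the six frame items → `_root_.Langlands` (glue proved inside, no glue binder). -/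
theorem langlands_of_four (hT : DyadicContinuousCompanion) (hG : DyadicDeRhamRigidity) (hI : DyadicIrreducibilityTransfer)
    (hU : DyadicLevelTransfer) (hK : ResidualInertiaDescent) (hWM : MinimalLevelDescent.WeightMove) (hLM : MinimalLevelDescent.LevelMove)
    (hB : MinimalLevelDescent.DyadicLevelOneAutomorphy) (hL : MinimalLevelDescent.AutomorphyLifting)
    (hW : MinimalLevelDescent.SatakeAvatarExistence) (hP : MinimalLevelDescent.PadicMemberCompatibility)
    (hA : MinimalLevelDescent.CompatibilityAwayFromLR) (hR : MinimalLevelDescent.CanonicalReciprocityData) :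
    _root_.Langlands :=
  langlands_of_pieces (dyadicCompanionExistence_of_TG hT hG) hI hU hK hWM hLM hB hL hW hP hA hR

-- (the consistency restatement `levelOneCrystallineDescent_of_langlands₈` — Langlands ⟹ Z through the FOUR pieces,
-- `levelOneCrystallineDescent_of_four (dyadicContinuousCompanion_of_langlands hLg) (dyadicDeRhamRigidity_of_langlands hLg)
-- (dyadicIrreducibilityTransfer_of_langlands hLg) (dyadicLevelTransfer_of_langlands hLg)` — is omitted here: its TYPE coincides with
-- part 3's `levelOneCrystallineDescent_of_langlands` (gate dedup.landed, cf. part 4); it is kept in the node file only.)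

end Structure8

end Summit.Langlands.Langlands.Theorems.LevelOneDyadic
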